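import Summits.QuantumFields.BalabanUV.T4Continuum.Support.NE7PairwiseFixedWindowCensus

/-!
# NE7PairwiseFixedWindowProfile — row NE7 (node U5), route «PAIR-CAUCHY» (R-P2, 1-bis): the RECENT-PROFILE kinds of
# road P1's budget (boundary group, common-constant deviation, the rate branch) at FIXED window depth in the NULL
# currency — a two-run MODULUS in place of the rate `θ^j` suffices at fixed depth for EVERY multiplicity base `Λ`, and
# does NOT suffice at P1's logarithmic window (kernel witness of «a null modulus cannot beat a multiplicity growing like
# a power of K»)

Cell `pub-balaban`, rung (B)+1 sub-cell t4, lineage `b2b-balaban-t4-ne7-p2` (CRUX PROVER NE7 #2 under the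
coordinator ruling «YM redirect», 2026-08-21; generation 57; texts: `HOME/t4/b2b-balaban-t4-ne7-p2/g57/ROUTE2-NE7-P2.md`
v1.12 §2 NODE S ∕ NODE W♭ and §15, the crux refuter's `HOME/b2b-balaban-t4-ne7-refuter/PRICING-NE7.md` v12.1 §70 (b)),
companion of `Support/NE7PairwiseFixedWindowCensus` (p262009 ∕ p262262: the ACTION kind at fixed depth) and of
`Support/NE7PairwiseCauchy` (p247800, (K3): the crossover kinds `Σ_m min(S m, ω(K − m)) → 0`).  HONEST FRAMING (page 1):
FIXED FINITE T⁴, rung (B)+1 = existence AND uniqueness of the `ε = L^{−K} → 0` limit of unit-scale averaged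
expectations, CONDITIONAL on BetaPertH and the nine spine estimates (0/9 proved); NOT infinite volume, NOT a mass gap,
NOT the Clay problem.  NE7 is NOT PRINTED in [Balaban1984PropagatorsI]–[Balaban1989LargeFieldII] and NOT proved here.
Everything below is [folklore] finite-sum ∕ limit bookkeeping over road P1's `T4RecentScale` ∕ `T4GoodClassBudget`
SHAPES (`RecentOnly`, `WindowMultiplicity`, `RecentDeviation`, `FactorLogBound`, `TermBudget`, `jlogOf`) with a general
profile in place of the rate; no definition, no cite tag, nothing printed asserted, no `sorry`.

WHY.  Road P1 budgets every RATE-ONLY recent kind of its term ledger — the boundary group (`T4GoodClassBudget.boundary_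
log_prod_le`), the common-constant deviation of the term constant (`RecentDeviation`, `abs_sum_dev_le_windowSum`), the
rate branch of the crossover kinds before minimisation (`T4RecentScale.sum_rate_le_crossoverShape`) — by the recent-scale
profile `Ck·(θ^{sc i} + δ_K(sc i))·w_i` (`θ` the two-run η-rate of rows NE3 ∕ NE5 ∕ NE9, `δ` node U2's coupling
discrepancy), sliced through the window multiplicity `Σ_{sc i = j} w_i ≤ Cw·vol·Λ^{K−j}` into `vol × windowSum θ Λ
(jlogOf Cl K) K`: the one place of the ledger where a two-run RATE must beat the multiplicity `Λ^{K−j}` of a window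
that DEEPENS with `K` (`summable_windowSum_log`).  Route R-P2 replaces every two-run rate by a NULL MODULUS and the
log window by a FIXED depth `w` (ROUTE2 §2 NODE S (v1.1): «a NULL modulus cannot beat a multiplicity growing like a
power of K; PAIR-CAUCHY therefore takes the window depth as a FREE, K-INDEPENDENT parameter and closes by a DOUBLE
LIMIT» — a sentence without a kernel witness since generation 48).  This file supplies both halves: with a GENERAL
profile `ω K j ≥ 0` the same slicing gives `≤ C·Cw·vol·Σ_{j ∈ [j⋆, K]} ω K j·Λ^{K−j}` (§1); at fixed depth `j⋆ = K+1−w`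
that sum is `Σ_{m < w} ω K (K−m)·Λ^m` — a FINITE sum over the co-depths `m` (block scales) — and is NULL in `K` for
EVERY real `Λ` as soon as the profile is null per co-depth, `∀ m, ω K (K − m) → 0` (§2): no rate, no summability, no
relation between the modulus and `Λ`.  That hypothesis is, BY SHAPE, the output of NODE T♭ (`NE7PairwiseTower.
termModulus_tendsto_zero : ∀ m, Tendsto (fun K ↦ T K m)`) and of (M♭′) (`NE7PairwiseMarginalBox.marginalBox_tendsto_
zero`) with `ω K j := T K (K − j)`; road P1's merged rate profile (`InjectedRate`, `θ < 1`) and any level modulus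
`ω₀(j) → 0` are instances (§2) — P1's currency is contained in the null currency.  CONTRAST (§4): at P1's logarithmic
window `[jlogOf C K, K]` the null polynomial modulus `(j+1)^{−C·log Λ}` keeps the window profile sum `≥ 1` for EVERY
`K` (the deepest level of the window alone contributes `(j₀+1)^{−C log Λ}·Λ^{⌈C log(K+1)⌉} ≥ 1`), for every `C ≥ 0`,
`Λ ≥ 1` — so in the null currency the window depth MUST be `K`-independent (or the modulus a rate: road P1), while at
any fixed depth the same modulus is harmless.

WHAT IS PROVED ([folklore]).
§1 **`sum_profile_le_windowProfile`** (general profile through `RecentOnly` + `WindowMultiplicity`),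
   **`abs_sum_dev_le_windowProfile`** (the common-constant deviation with `|e_i| ≤ Cs·ω(sc i)·w_i`),
   `abs_sum_dev_le_windowProfile_of_recentDeviation` (P1's `RecentDeviation` is the instance `ω j = θ^j + δ_K j`,
   un-merged — no `InjectedRate` needed), **`log_prod_le_windowProfile`** (the boundary-group ∕ factor-ledger form:
   `FactorLogBound` with remainders dominated by the ω-profile ⟹ `|log ∏ f^B − log ∏ f^A − Σ c| ≤ Ck·Cw·vol·Σ ω Λ^{K−j}`).
§2 `image_sub_range_eq_Icc`, **`sum_windowProfile_fixedDepth_eq`** (re-indexing by the co-depth `m = K − j`),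
   **`tendsto_windowProfile_fixedDepth`** (THE FIXED-DEPTH PROFILE SUM IS NULL, every `Λ : ℝ`, hypothesis
   `∀ m, ω K (K − m) → 0`); instances **`tendsto_coDepth_of_levelModulus`**, **`tendsto_coDepth_of_injectedRate`**
   (road P1's rate currency), **`tendsto_coDepth_of_termModulus`** (NODE T♭ ∕ (M♭′) by shape).
§3 THE CONSUMER SHAPES AT FIXED DEPTH: **`deviation_of_fixedDepthProfile`** (`T4GoodClassBudget.TermBudget`'s
   `deviation` clause `|Cc K t τ − c₀ K| ≤ vol·s_K` with the explicit `s_K = Cs·Cw·Σ_{j ∈ [K+1−w, K]} ω K j Λ^{K−j}`),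
   **`tendsto_devBudget_fixedDepth`** (`s_K → 0`), `logProd_of_fixedDepthProfile` (boundary group, per admissible
   field), **`goodClause_null_of_termBudget`** (a term budget with NULL `r`, `s` gives road P1's `GoodClause` with a
   NULL remainder — the currency of the (E♭) socket's input (5a), `NE7PairwiseOffsetEndSeq` ∕ `NE7PairwiseFibreSplit`).
§4 CONTRAST AT THE LOG WINDOW: `tendsto_powProfile` (`(j+1)^{−C log Λ} → 0` for `C > 0`, `Λ > 1`),
   **`one_le_logWindowProfile`** (`1 ≤ Σ_{j ∈ [jlogOf C K, K]} (j+1)^{−C log Λ}·Λ^{K−j}` for all `K`, `C ≥ 0`, `Λ ≥ 1`),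
   **`not_tendsto_logWindowProfile`**, and `tendsto_fixedDepth_powProfile` (the same modulus at fixed depth: null).

NOT DELIVERED: that road P1's boundary ∕ deviation ∕ rate-branch remainders for the PAIR `(K, K + ν K)` HAVE the
ω-profile shape with a null-per-co-depth modulus on the depth-`w` good class ((E♭-inst) (i): P1's END assembled with
the window depth as a parameter — its ten `Termwise*` ledgers hard-wire `hBwin : RecentOnly … (jlogOf Cl K) K`; XL
re-typing, not attempted), the moduli themselves (rows NE3 ∕ NE5 ∕ NE9 ∕ node U2 in the null, per-sequence currency —
supplier asks, unchanged), the multiplicities and window clauses (design ∕ hypothesis shapes).  After p247800 (K3),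
p262009 (action kind) and this file every `windowSum`- or crossover-budgeted kind of road P1's remainder has a
fixed-depth null-currency census at SHAPE level; nothing of it is instantiated on Bałaban's runs.  NOT NE7 (spine 0/9
unchanged), NOT summit progress.  HONEST DEPENDENCY: continuum YM on T⁴ ⇐ BetaPertH ∧ nine spine estimates (0/9
proved); BetaPertH ⇐ (D1) ∧ (D4) ∧ CAP+tail; G-an2-4 gates asym, D1 and NE2/3/4.
-/

noncomputable section

open Finset _root_.Filter _root_.Topology
open scoped BigOperators

namespace Summit.QuantumFields.BalabanUV.T4Continuum.NE7PairwiseFixedWindowProfile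

open Literature.MathematicalPhysics.QuantumFieldTheory.Balaban1983to89
open T4GoodClassBudget (RecentOnly WindowMultiplicity RecentDeviation TermBudget GoodClause goodClause_of_termBudget
  jlogOf jlogOf_le rpow_log_swap)
open T4RecentScale (FactorLogBound sum_profile_le_of_slices)

/-! ## §1 A GENERAL profile sliced through the window multiplicity -/

section Slicing

variable {κ : Type*} {dof : Finset κ} {sc : κ → ℕ} {wt : κ → ℝ}

/-- **GENERAL PROFILE THROUGH THE WINDOW.**  Recent-only degrees of freedom (creation scales in `[j⋆, K]`) with window
multiplicity `Σ_{sc i = j} w_i ≤ Cw·vol·Λ^{K−j}` and a per-scale coefficient `C·ω j`, `ω ≥ 0` on the window: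
`Σ_i C·ω(sc i)·w_i ≤ C·(Cw·vol)·Σ_{j ∈ [j⋆, K]} ω j·Λ^{K−j}` — `T4GoodClassBudget.sum_rate_le_windowSum` with the rate
`θ^j` replaced by any profile. [folklore] -/
theorem sum_profile_le_windowProfile {ω : ℕ → ℝ} {Cw vol Λ C : ℝ} {jstar K : ℕ} (hC : 0 ≤ C)
    (hω : ∀ j, jstar ≤ j → j ≤ K → 0 ≤ ω j) (hrec : RecentOnly dof sc jstar K)
    (hM : WindowMultiplicity dof sc wt Cw vol Λ jstar K) :
    ∑ i ∈ dof, C * ω (sc i) * wt i ≤ C * (Cw * vol) * ∑ j ∈ Icc jstar K, ω j * Λ ^ (K - j) := by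
  have hsc : ∀ i ∈ dof, sc i ∈ Icc jstar K := fun i hi => mem_Icc.mpr (hrec i hi)
  calc ∑ i ∈ dof, C * ω (sc i) * wt i
      ≤ ∑ j ∈ Icc jstar K, C * ω j * (Cw * vol * Λ ^ (K - j)) :=
        sum_profile_le_of_slices (ρ := fun j => C * ω j) (M := fun j => Cw * vol * Λ ^ (K - j)) hsc
          (fun j hj => mul_nonneg hC (hω j (mem_Icc.mp hj).1 (mem_Icc.mp hj).2))
          (fun j hj => hM j (mem_Icc.mp hj).1 (mem_Icc.mp hj).2)
    _ = C * (Cw * vol) * ∑ j ∈ Icc jstar K, ω j * Λ ^ (K - j) := by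
        rw [Finset.mul_sum]
        exact sum_congr rfl fun j _ => by ring

/-- **THE COMMON-CONSTANT DEVIATION WITH A GENERAL PROFILE.**  If every recent degree of freedom deviates by
`|e_i| ≤ Cs·ω(sc i)·w_i` (P1's `RecentDeviation.dev_le` with `θ^j + δ_K j` replaced by `ω j`), then
`|Σ_i e_i| ≤ Cs·(Cw·vol)·Σ_{j ∈ [j⋆, K]} ω j·Λ^{K−j}`. [folklore] -/
theorem abs_sum_dev_le_windowProfile {e : κ → ℝ} {ω : ℕ → ℝ} {Cs Cw vol Λ : ℝ} {jstar K : ℕ} (hCs : 0 ≤ Cs)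
    (hω : ∀ j, jstar ≤ j → j ≤ K → 0 ≤ ω j) (hdev : ∀ i ∈ dof, |e i| ≤ Cs * ω (sc i) * wt i)
    (hrec : RecentOnly dof sc jstar K) (hM : WindowMultiplicity dof sc wt Cw vol Λ jstar K) :
    |∑ i ∈ dof, e i| ≤ Cs * (Cw * vol) * ∑ j ∈ Icc jstar K, ω j * Λ ^ (K - j) :=
  calc |∑ i ∈ dof, e i| ≤ ∑ i ∈ dof, |e i| := abs_sum_le_sum_abs _ _
    _ ≤ ∑ i ∈ dof, Cs * ω (sc i) * wt i := sum_le_sum hdev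
    _ ≤ Cs * (Cw * vol) * ∑ j ∈ Icc jstar K, ω j * Λ ^ (K - j) := sum_profile_le_windowProfile hCs hω hrec hM

/-- Road P1's `RecentDeviation` (profile `θ^j + δ_K j`) is the instance `ω j := θ^j + δ_K j`, UN-MERGED: no
`InjectedRate` hypothesis is needed to state the window bound (P1's `abs_sum_dev_le_windowSum` merges `δ` into the
rate first). [folklore] -/
theorem abs_sum_dev_le_windowProfile_of_recentDeviation {e : κ → ℝ} {Cs θ Cw vol Λ : ℝ} {δ : ℕ → ℝ} {jstar K : ℕ}
    (h : RecentDeviation dof sc wt e Cs θ δ Cw vol Λ jstar K) (hCs : 0 ≤ Cs) (hθ : 0 ≤ θ)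
    (hδ : ∀ j, jstar ≤ j → j ≤ K → 0 ≤ δ j) :
    |∑ i ∈ dof, e i| ≤ Cs * (Cw * vol) * ∑ j ∈ Icc jstar K, (θ ^ j + δ j) * Λ ^ (K - j) :=
  abs_sum_dev_le_windowProfile (ω := fun j => θ ^ j + δ j) hCs
    (fun j h1 h2 => add_nonneg (pow_nonneg hθ j) (hδ j h1 h2)) h.dev_le h.recent h.mult

/-- **THE FACTOR-LEDGER ∕ BOUNDARY-GROUP FORM WITH A GENERAL PROFILE.**  A per-factor log-ratio bound on the
admissible set (`T4RecentScale.FactorLogBound`) whose remainders are dominated by the ω-profile, `r_i ≤ Ck·ω(sc i)·w_i`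
(any kind table fits under one `Ck`), for recent-only factors with window multiplicity ⟹
`|log ∏ f^B − log ∏ f^A − Σ c_i| ≤ Ck·(Cw·vol)·Σ_{j ∈ [j⋆, K]} ω j·Λ^{K−j}` — `T4GoodClassBudget.boundary_log_prod_le` with
the rate replaced by any profile. [folklore] -/
theorem log_prod_le_windowProfile {V : Type*} {Adm : Set V} {fA fB : κ → V → ℝ} {c r : κ → ℝ} {ω : ℕ → ℝ}
    {Ck Cw vol Λ : ℝ} {jstar K : ℕ} (h : FactorLogBound Adm dof fA fB c r)
    (hr : ∀ i ∈ dof, r i ≤ Ck * ω (sc i) * wt i) (hCk : 0 ≤ Ck) (hω : ∀ j, jstar ≤ j → j ≤ K → 0 ≤ ω j)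
    (hrec : RecentOnly dof sc jstar K) (hM : WindowMultiplicity dof sc wt Cw vol Λ jstar K) :
    ∀ v ∈ Adm, |Real.log (∏ i ∈ dof, fB i v) - Real.log (∏ i ∈ dof, fA i v) - ∑ i ∈ dof, c i|
      ≤ Ck * (Cw * vol) * ∑ j ∈ Icc jstar K, ω j * Λ ^ (K - j) :=
  fun v hv => (h.log_prod v hv).trans ((sum_le_sum hr).trans (sum_profile_le_windowProfile hCk hω hrec hM))

end Slicing

/-! ## §2 At FIXED depth the window profile sum is a finite sum over co-depths — null for every `Λ` -/

section FixedDepth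

/-- The fixed-depth window `[K+1−w, K]` is the image of the co-depths `m < w` under `m ↦ K − m` (for `w ≤ K+1`).
[folklore] -/
theorem image_sub_range_eq_Icc {w K : ℕ} (hw : w ≤ K + 1) :
    (range w).image (fun m => K - m) = Icc (K + 1 - w) K := by
  ext j
  simp only [mem_image, mem_range, mem_Icc]
  constructor
  · rintro ⟨m, hm, rfl⟩
    omega
  · rintro ⟨h1, h2⟩
    exact ⟨K - j, by omega, by omega⟩

/-- **RE-INDEXING BY THE CO-DEPTH** (`m = K − j` = the block scale at birth): for `w ≤ K+1`,
`Σ_{j ∈ [K+1−w, K]} ω j·Λ^{K−j} = Σ_{m < w} ω (K−m)·Λ^m`. [folklore] -/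
theorem sum_windowProfile_fixedDepth_eq (ω : ℕ → ℝ) (Λ : ℝ) {w K : ℕ} (hw : w ≤ K + 1) :
    ∑ j ∈ Icc (K + 1 - w) K, ω j * Λ ^ (K - j) = ∑ m ∈ range w, ω (K - m) * Λ ^ m := by
  rw [← image_sub_range_eq_Icc hw, sum_image]
  · exact sum_congr rfl fun m hm => by
      have hmK : K - (K - m) = m := by have := mem_range.mp hm; omega
      rw [hmK]
  · intro m₁ hm₁ m₂ hm₂ h
    have h1 := mem_range.mp (mem_coe.mp hm₁)
    have h2 := mem_range.mp (mem_coe.mp hm₂)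
    have h' : K - m₁ = K - m₂ := h
    omega

/-- **THE FIXED-DEPTH WINDOW PROFILE SUM IS NULL, FOR EVERY `Λ`.**  If the (cutoff-indexed) profile is null per
co-depth — `∀ m, ω K (K − m) → 0` as `K → ∞` (the two-run modulus of the terms born at block scale `m`, null at every
FIXED `m`) — then `Σ_{j ∈ [K+1−w, K]} ω K j·Λ^{K−j} → 0` at every FIXED depth `w`: a finite sum of null sequences times
the constants `Λ^m`, `m < w`.  No rate, no summability, no relation between the modulus and the multiplicity base.
[folklore] -/
theorem tendsto_windowProfile_fixedDepth {ω : ℕ → ℕ → ℝ} (Λ : ℝ) (w : ℕ)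
    (hω : ∀ m, Tendsto (fun K => ω K (K - m)) atTop (𝓝 0)) :
    Tendsto (fun K => ∑ j ∈ Icc (K + 1 - w) K, ω K j * Λ ^ (K - j)) atTop (𝓝 0) := by
  have h1 : Tendsto (fun K => ∑ m ∈ range w, ω K (K - m) * Λ ^ m) atTop (𝓝 0) := by
    have h := tendsto_finsetSum (range w) fun m (_ : m ∈ range w) => (hω m).mul_const (Λ ^ m)
    simpa using h
  refine h1.congr' ?_
  filter_upwards [eventually_ge_atTop w] with K hK
  exact (sum_windowProfile_fixedDepth_eq (ω K) Λ (by omega)).symm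

/-- INSTANCE (i): a LEVEL MODULUS `ω₀(j) → 0` (depending on the creation scale only) is null per co-depth.
[folklore] -/
theorem tendsto_coDepth_of_levelModulus {ω₀ : ℕ → ℝ} (h : Tendsto ω₀ atTop (𝓝 0)) (m : ℕ) :
    Tendsto (fun K => ω₀ (K - m)) atTop (𝓝 0) :=
  h.comp (tendsto_sub_atTop_nat m)

/-- INSTANCE (ii): ROAD P1's MERGED RATE PROFILE `θ^j + δ_K j` with node U2's `InjectedRate Cδ 0 θ δ` and `0 ≤ θ < 1` is
null per co-depth — P1's rate currency is contained in the null currency. [folklore] -/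
theorem tendsto_coDepth_of_injectedRate {θ Cδ : ℝ} {δ : ℕ → ℕ → ℝ} (hθ : 0 ≤ θ) (hθ1 : θ < 1)
    (hδ : T4CauchySum.InjectedRate Cδ 0 θ δ) (m : ℕ) :
    Tendsto (fun K => θ ^ (K - m) + δ K (K - m)) atTop (𝓝 0) := by
  have hp : Tendsto (fun K => θ ^ (K - m)) atTop (𝓝 0) :=
    (tendsto_pow_atTop_nhds_zero_of_lt_one hθ hθ1).comp (tendsto_sub_atTop_nat m)
  have hd : Tendsto (fun K => δ K (K - m)) atTop (𝓝 0) := by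
    refine squeeze_zero (fun K => (hδ K (K - m) (Nat.sub_le K m)).1) (fun K => ?_)
      (by simpa using hp.const_mul Cδ)
    have h2 := (hδ K (K - m) (Nat.sub_le K m)).2
    simpa using h2
  simpa using hp.add hd

/-- INSTANCE (iii): NODE T♭'s ∕ (M♭′)'s OUTPUT SHAPE.  `NE7PairwiseTower.termModulus_tendsto_zero` and
`NE7PairwiseMarginalBox.marginalBox_tendsto_zero` conclude `∀ m, Tendsto (fun K ↦ T K m) atTop (𝓝 0)` for the two-run
modulus of the terms born at block scale `m`; read as a creation-scale profile `ω K j := T K (K − j)` it is null per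
co-depth (the two indexings agree for `m ≤ K`). [folklore] -/
theorem tendsto_coDepth_of_termModulus {T : ℕ → ℕ → ℝ} (hT : ∀ m, Tendsto (fun K => T K m) atTop (𝓝 0)) (m : ℕ) :
    Tendsto (fun K => (fun K' j => T K' (K' - j)) K (K - m)) atTop (𝓝 0) := by
  refine (hT m).congr' ?_
  filter_upwards [eventually_ge_atTop m] with K hK
  show T K m = T K (K - (K - m))
  rw [Nat.sub_sub_self hK]

end FixedDepth

/-! ## §3 The consumer shapes at fixed depth: `TermBudget`'s deviation clause, the boundary group, the null good
clause -/

section Consumers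

variable {κ : Type*}

/-- **THE COMMON-CONSTANT BUDGET AT FIXED DEPTH.**  If on the good class every term constant is the class constant plus
the deviations of the term's degrees of freedom, `Cc K t τ = c₀ K + Σ_{i ∈ dof} e_i`, each deviation obeys
`|e_i| ≤ Cs·ω K (sc i)·w_i` with `ω ≥ 0`, and the degrees of freedom are RECENT-ONLY AT DEPTH `w` (creation scales in
`[K+1−w, K]` — the window clause `hBwin` of road P1's ledgers read at a K-independent depth) with window multiplicity
(`0 ≤ Cw`, `0 ≤ vol`), then `T4GoodClassBudget.TermBudget`'s `deviation` clause holds with the EXPLICIT per-unit-volume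
budget `s_K = Cs·Cw·Σ_{j ∈ [K+1−w, K]} ω K j·Λ^{K−j}`. [folklore] -/
theorem deviation_of_fixedDepthProfile {ι : Type*} [DecidableEq ι] {l₀ vol : ℝ} {T : ℕ → Finset ι}
    {Bad : ℕ → ℝ → Finset ι} {Cc : ℕ → ℝ → ι → ℝ} {c₀ : ℕ → ℝ} {dof : ℕ → ℝ → ι → Finset κ}
    {sc : ℕ → ℝ → ι → κ → ℕ} {wt e : ℕ → ℝ → ι → κ → ℝ} {ω : ℕ → ℕ → ℝ} {Cs Cw Λ : ℝ} {w : ℕ}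
    (hCs : 0 ≤ Cs) (hω0 : ∀ K j, 0 ≤ ω K j)
    (hC : ∀ K t, |t| ≤ l₀ → ∀ τ ∈ T K \ Bad K t, Cc K t τ = c₀ K + ∑ i ∈ dof K t τ, e K t τ i)
    (hdev : ∀ K t, |t| ≤ l₀ → ∀ τ ∈ T K \ Bad K t, ∀ i ∈ dof K t τ,
      |e K t τ i| ≤ Cs * ω K (sc K t τ i) * wt K t τ i)
    (hrec : ∀ K t, |t| ≤ l₀ → ∀ τ ∈ T K \ Bad K t, RecentOnly (dof K t τ) (sc K t τ) (K + 1 - w) K)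
    (hM : ∀ K t, |t| ≤ l₀ → ∀ τ ∈ T K \ Bad K t,
      WindowMultiplicity (dof K t τ) (sc K t τ) (wt K t τ) Cw vol Λ (K + 1 - w) K) :
    ∀ K t, |t| ≤ l₀ → ∀ τ ∈ T K \ Bad K t,
      |Cc K t τ - c₀ K| ≤ vol * (Cs * Cw * ∑ j ∈ Icc (K + 1 - w) K, ω K j * Λ ^ (K - j)) := by
  intro K t ht τ hτ
  rw [hC K t ht τ hτ, add_sub_cancel_left]
  calc |∑ i ∈ dof K t τ, e K t τ i| ≤ Cs * (Cw * vol) * ∑ j ∈ Icc (K + 1 - w) K, ω K j * Λ ^ (K - j) :=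
        abs_sum_dev_le_windowProfile hCs (fun j _ _ => hω0 K j) (hdev K t ht τ hτ) (hrec K t ht τ hτ)
          (hM K t ht τ hτ)
    _ = vol * (Cs * Cw * ∑ j ∈ Icc (K + 1 - w) K, ω K j * Λ ^ (K - j)) := by ring

/-- … and THAT BUDGET IS NULL when the profile is null per co-depth (`∀ m, ω K (K − m) → 0`), for every `Λ`: the
`s`-half of a `TermBudget` in route R-P2's currency. [folklore] -/
theorem tendsto_devBudget_fixedDepth {ω : ℕ → ℕ → ℝ} (Cs Cw Λ : ℝ) (w : ℕ)
    (hω : ∀ m, Tendsto (fun K => ω K (K - m)) atTop (𝓝 0)) :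
    Tendsto (fun K => Cs * Cw * ∑ j ∈ Icc (K + 1 - w) K, ω K j * Λ ^ (K - j)) atTop (𝓝 0) := by
  simpa using (tendsto_windowProfile_fixedDepth Λ w hω).const_mul (Cs * Cw)

/-- **THE BOUNDARY GROUP AT FIXED DEPTH**, per cutoff and admissible field: a factor ledger with per-factor log-ratio
remainders dominated by the ω-profile, recent-only at depth `w`, with window multiplicity ⟹ `|log ∏ f^B − log ∏ f^A −
Σ c| ≤ vol·(Ck·Cw·Σ_{j ∈ [K+1−w, K]} ω K j·Λ^{K−j})` — the `r`-contribution of the boundary kind to a `TermBudget`, null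
in `K` by `tendsto_devBudget_fixedDepth`. [folklore] -/
theorem logProd_of_fixedDepthProfile {V : Type*} {Adm : Set V} {fac : Finset κ} {sc : κ → ℕ} {wt c r : κ → ℝ}
    {fA fB : κ → V → ℝ} {ω : ℕ → ℕ → ℝ} {Ck Cw vol Λ : ℝ} {w K : ℕ}
    (h : FactorLogBound Adm fac fA fB c r) (hr : ∀ i ∈ fac, r i ≤ Ck * ω K (sc i) * wt i) (hCk : 0 ≤ Ck)
    (hω0 : ∀ j, 0 ≤ ω K j) (hrec : RecentOnly fac sc (K + 1 - w) K)
    (hM : WindowMultiplicity fac sc wt Cw vol Λ (K + 1 - w) K) :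
    ∀ v ∈ Adm, |Real.log (∏ i ∈ fac, fB i v) - Real.log (∏ i ∈ fac, fA i v) - ∑ i ∈ fac, c i|
      ≤ vol * (Ck * Cw * ∑ j ∈ Icc (K + 1 - w) K, ω K j * Λ ^ (K - j)) := fun v hv =>
  calc |Real.log (∏ i ∈ fac, fB i v) - Real.log (∏ i ∈ fac, fA i v) - ∑ i ∈ fac, c i|
      ≤ Ck * (Cw * vol) * ∑ j ∈ Icc (K + 1 - w) K, ω K j * Λ ^ (K - j) :=
        log_prod_le_windowProfile h hr hCk (fun j _ _ => hω0 j) hrec hM v hv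
    _ = vol * (Ck * Cw * ∑ j ∈ Icc (K + 1 - w) K, ω K j * Λ ^ (K - j)) := by ring

/-- **THE JUNCTION WITH THE (E♭) SOCKET's CURRENCY.**  Road P1's per-term budget (`T4GoodClassBudget.TermBudget`: own
constant and remainder per good term, remainder `≤ vol·r_K`, constant within `vol·s_K` of the class constant) with NULL
`r` and `s` gives road P1's `GoodClause` (`goodClause_of_termBudget`, remainder `r + s`) WITH A NULL REMAINDER — the
currency in which `NE7PairwiseOffsetEndSeq` ∕ `NE7PairwiseFibreSplit` consume input (5a).  P1's own exit asks
`Summable (r + s)` instead. [folklore] -/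
theorem goodClause_null_of_termBudget {ι : Type*} [DecidableEq ι] {l₀ vol : ℝ} {T : ℕ → Finset ι}
    {A B : ℕ → ℝ → ι → ℝ} {Bad : ℕ → ℝ → Finset ι} {Cc Rr : ℕ → ℝ → ι → ℝ} {c₀ r s : ℕ → ℝ}
    (h : TermBudget l₀ vol T A B Bad Cc Rr c₀ r s) (hr : Tendsto r atTop (𝓝 0)) (hs : Tendsto s atTop (𝓝 0)) :
    GoodClause l₀ vol T A B Bad (fun K => r K + s K) ∧ Tendsto (fun K => r K + s K) atTop (𝓝 0) :=
  ⟨goodClause_of_termBudget h, by simpa using hr.add hs⟩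

end Consumers

/-! ## §4 Contrast: at road P1's LOGARITHMIC window a null modulus does NOT suffice -/

section Contrast

/-- The polynomial level modulus `(j+1)^{−C·log Λ}` is NULL for `C > 0`, `Λ > 1`. [folklore] -/
theorem tendsto_powProfile {C Λ : ℝ} (hC : 0 < C) (hΛ : 1 < Λ) :
    Tendsto (fun j : ℕ => ((j : ℝ) + 1) ^ (-(C * Real.log Λ))) atTop (𝓝 0) := by
  have hp : 0 < C * Real.log Λ := mul_pos hC (Real.log_pos hΛ)
  have h1 : Tendsto (fun j : ℕ => (j : ℝ) + 1) atTop atTop :=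
    tendsto_atTop_add_const_right _ 1 tendsto_natCast_atTop_atTop
  exact (tendsto_rpow_neg_atTop hp).comp h1

/-- **AT THE LOG WINDOW THE NULL MODULUS `(j+1)^{−C log Λ}` DOES NOT MAKE THE WINDOW PROFILE SMALL**: for every `C ≥ 0`,
`Λ ≥ 1` and EVERY cutoff `K`, `1 ≤ Σ_{j ∈ [jlogOf C K, K]} (j+1)^{−C log Λ}·Λ^{K−j}` — the deepest level `j₀ = jlogOf C K`
of the window alone contributes `(j₀+1)^{−C log Λ}·Λ^{⌈C log(K+1)⌉} ≥ (K+1)^{−C log Λ}·(K+1)^{C log Λ} = 1` (and `Λ^K ≥ 1`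
when the window is everything).  «A null modulus cannot beat a multiplicity growing like a power of K.» [folklore] -/
theorem one_le_logWindowProfile {C Λ : ℝ} (hC : 0 ≤ C) (hΛ : 1 ≤ Λ) (K : ℕ) :
    1 ≤ ∑ j ∈ Icc (jlogOf C K) K, ((j : ℝ) + 1) ^ (-(C * Real.log Λ)) * Λ ^ (K - j) := by
  have hΛ0 : 0 < Λ := one_pos.trans_le hΛ
  have hj₀K : jlogOf C K ≤ K := jlogOf_le C K
  have hmem : jlogOf C K ∈ Icc (jlogOf C K) K := mem_Icc.mpr ⟨le_rfl, hj₀K⟩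
  have hnn : ∀ j ∈ Icc (jlogOf C K) K, 0 ≤ ((j : ℝ) + 1) ^ (-(C * Real.log Λ)) * Λ ^ (K - j) :=
    fun j _ => mul_nonneg (Real.rpow_nonneg (by positivity) _) (pow_nonneg hΛ0.le _)
  refine le_trans ?_ (single_le_sum hnn hmem)
  by_cases hcase : ⌈C * Real.log ((K : ℝ) + 1)⌉₊ ≤ K
  · -- the window has `⌈C·log(K+1)⌉ + 1` levels; its deepest level carries the multiplicity `Λ^{⌈C·log(K+1)⌉}`
    have hn : K - jlogOf C K = ⌈C * Real.log ((K : ℝ) + 1)⌉₊ := by unfold jlogOf; omega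
    have hK1 : (0 : ℝ) < (K : ℝ) + 1 := by positivity
    have hj1 : (0 : ℝ) < (jlogOf C K : ℝ) + 1 := by positivity
    have hle : (jlogOf C K : ℝ) + 1 ≤ (K : ℝ) + 1 := by
      have : (jlogOf C K : ℝ) ≤ K := by exact_mod_cast hj₀K
      linarith
    have hpow : ((K : ℝ) + 1) ^ (C * Real.log Λ) ≤ Λ ^ (K - jlogOf C K) := by
      rw [← rpow_log_swap hΛ0 C K, hn, ← Real.rpow_natCast]
      exact Real.rpow_le_rpow_of_exponent_le hΛ (Nat.le_ceil _)
    have hω : ((K : ℝ) + 1) ^ (-(C * Real.log Λ)) ≤ ((jlogOf C K : ℝ) + 1) ^ (-(C * Real.log Λ)) :=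
      Real.rpow_le_rpow_of_nonpos hj1 hle
        (by have := mul_nonneg hC (Real.log_nonneg hΛ); linarith)
    calc (1 : ℝ) = ((K : ℝ) + 1) ^ (-(C * Real.log Λ)) * ((K : ℝ) + 1) ^ (C * Real.log Λ) := by
          rw [Real.rpow_neg hK1.le, inv_mul_cancel₀ (Real.rpow_pos_of_pos hK1 _).ne']
      _ ≤ ((jlogOf C K : ℝ) + 1) ^ (-(C * Real.log Λ)) * Λ ^ (K - jlogOf C K) :=
          mul_le_mul hω hpow (Real.rpow_nonneg hK1.le _) (Real.rpow_nonneg hj1.le _)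
  · -- the window is the whole range `[0, K]`: the level `0` carries `Λ^K ≥ 1`
    have hj0 : jlogOf C K = 0 := by unfold jlogOf; omega
    rw [hj0]
    simp only [Nat.cast_zero, zero_add, Real.one_rpow, one_mul, Nat.sub_zero]
    exact one_le_pow₀ hΛ

/-- **HENCE NOT NULL AT THE LOG WINDOW**: with the null modulus `(j+1)^{−C log Λ}` the log-window profile sum does not
tend to `0` (`C ≥ 0`, `Λ ≥ 1`) — in the null currency the window depth must be `K`-independent, or the modulus must be a
rate (road P1's `summable_windowSum_log`). [folklore] -/
theorem not_tendsto_logWindowProfile {C Λ : ℝ} (hC : 0 ≤ C) (hΛ : 1 ≤ Λ) :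
    ¬ Tendsto (fun K => ∑ j ∈ Icc (jlogOf C K) K, ((j : ℝ) + 1) ^ (-(C * Real.log Λ)) * Λ ^ (K - j))
      atTop (𝓝 0) := by
  intro h
  obtain ⟨K, hK⟩ := (h.eventually (gt_mem_nhds one_pos)).exists
  exact lt_irrefl (1 : ℝ) ((one_le_logWindowProfile hC hΛ K).trans_lt hK)

/-- … while AT ANY FIXED DEPTH the same modulus is harmless: the fixed-depth profile sum is null (§2, instance (i)).
[folklore] -/
theorem tendsto_fixedDepth_powProfile {C Λ : ℝ} (hC : 0 < C) (hΛ : 1 < Λ) (w : ℕ) :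
    Tendsto (fun K => ∑ j ∈ Icc (K + 1 - w) K, ((j : ℝ) + 1) ^ (-(C * Real.log Λ)) * Λ ^ (K - j))
      atTop (𝓝 0) :=
  tendsto_windowProfile_fixedDepth (ω := fun _ j => ((j : ℝ) + 1) ^ (-(C * Real.log Λ))) Λ w
    (tendsto_coDepth_of_levelModulus (tendsto_powProfile hC hΛ))

end Contrast

end Summit.QuantumFields.BalabanUV.T4Continuum.NE7PairwiseFixedWindowProfile

end
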